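import Mathlib
import Literature.Computability.AlgebraicComplexity.StandardFamilies

/-! Proposed item signatures (lead c3, cycle 4 report §Proposed outcome) — elaboration check only;
NOT a proposal.  `CoPermanentIndependence` (CPI) and `WordPerQuarticLog`; the glue
`CoPermanentIndependence → WordPerQuarticLog` is provable now from the WordPerCubic engine
(`stub_segmentSubalgebra`, `stub_card_le_of_algebraicIndependent`) and this line's block transport. -/

open MvPolynomial Literature.Computability.AlgebraicComplexity

namespace Summit.ValiantsHypothesis.ValiantsHypothesis.Cruxes.WordPerSuperQuartic.Proposed

/-- CPI, diagonal-block form: for some `K` and `c > 0` and all large `n`, among the coefficients of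
`per_n` with respect to the diagonal block variables `x_ii`, `i < K·log₂ n` (the other variables kept
as polynomial coefficients), at least `c·n²` are algebraically independent over `ℂ`. -/
def CoPermanentIndependence : Prop :=
  ∃ K : ℕ, ∃ c : ℝ, 0 < c ∧ ∃ n₀ : ℕ, ∀ n ≥ n₀,
    ∃ s : Finset ((Fin n × Fin n) →₀ ℕ), c * (n : ℝ) ^ 2 ≤ s.card ∧
      AlgebraicIndependent ℂ (fun μ : s => coeff (μ : (Fin n × Fin n) →₀ ℕ)
        (aeval (fun v : Fin n × Fin n => if v.1 = v.2 ∧ (v.1 : ℕ) < K * Nat.log 2 n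
          then (X v : MvPolynomial (Fin n × Fin n) (MvPolynomial (Fin n × Fin n) ℂ)) else C (X v))
          (perPoly (Fin n) ℂ)))

/-- The counting ceiling for the permanent: every affine elementary word for `E_02(per_n)` has
length `≥ c·n⁴/log n`. -/
def WordPerQuarticLog : Prop :=
  ∃ c : ℝ, 0 < c ∧ ∃ n₀ : ℕ, ∀ n ≥ n₀, ∀ L : ℕ,
    (∃ w : List (Fin 3 × Fin 3 × ℂ × Option (Fin n × Fin n)), w.length ≤ L ∧ (∀ l ∈ w, l.1 ≠ l.2.1) ∧
      (w.map (fun l => Matrix.transvection l.1 l.2.1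
        (MvPolynomial.C l.2.2.1 * l.2.2.2.elim 1 MvPolynomial.X))).prod =
        Matrix.transvection (0 : Fin 3) 2 (perPoly (Fin n) ℂ)) →
    c * (n : ℝ) ^ 4 / Real.log n ≤ L

/-- Glue (provable now; ≈ 300 lines): CPI gives the quartic-over-log bound. -/
theorem wordPerQuarticLog_of_coPermanentIndependence :
    CoPermanentIndependence → WordPerQuarticLog := by
  sorry

end Summit.ValiantsHypothesis.ValiantsHypothesis.Cruxes.WordPerSuperQuartic.Proposed
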